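import Mathlib
import Summits.NavierStokesRegularity.NavierStokesRegularity.Theorems.EulerZoomLiouvillePowerGaugeEulerLiouvilleNeedleMomentumTransport

/-!
# The gradient Riccati along backward similarity orbits (self-similar Euler, `C²` profiles)

For a `C²` self-similar Euler profile `(U, P)` with exponent `γ` and centre `0`
(`(1−γ)U + DU·W + ∇P = 0`, `W y = γy + U y`, `div U = 0`) we record the EXACT differentiated form of the profile
equation and its reading along backward orbits `Ψ' = −W(Ψ)` of the (cut-off) transport field:

* `hasFDerivAt_selfSimilarTransport_zero` — `DW(y) = γ·id + DU(y)`;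
* `gradient_pressure_eq` — `∇P = −(1−γ)U − DU·W` as functions, hence
  `hasFDerivAt_gradient_pressure` — `∇P` is differentiable (the profile's pressure is effectively `C²`) with
  `D(∇P)(y) = −(1−γ)DU(y) − DU(y)∘(γ·id + DU(y)) − (D²U(y))ᵀ·W(y)` (`ᵀ` = `flip`);
* `fderiv_fderiv_apply_transport_eq_flip` — symmetry of `D²U` (`C²`): `D²U(y)(W y) = (D²U(y)).flip (W y)`;
* **`hasDerivAt_fderiv_velocity_flow_neg` (THE RICCATI)** — while the backward cut-off orbit `Ψ_σ y` stays in the ball where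
  `V = U`, the matrix `A(σ) := DU(Ψ_σ y)` satisfies `A' = A + A∘A + D(∇P)(Ψ_σ y)`.

READING (R44-5): pressure-free this is the matrix Riccati equation, which blows up in backward time `≈ 1/Re λ` at an
expanding eigenvalue `λ`; a globally `C²` profile therefore pays a pressure Hessian `≳ λ²` near every strongly expanding
point, and super-exponential gradients (THEOREM B, `…CondenserGaugeForm`) are ACCUMULATED along whole orbit segments.
Not NS, not E: identities only; crux 19832 stays OPEN.
-/

noncomputable section

open Set Metric Filter Topology Function InnerProductSpace MeasureTheory
open scoped RealInnerProductSpace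

set_option linter.dupNamespace false

namespace Summit.NavierStokesRegularity.NavierStokesRegularity.Theorems.PowerGaugeEulerLiouville.Condenser

open Literature.Analysis Literature.Analysis.FluidPDE
open Summit.NavierStokesRegularity.NavierStokesRegularity.Theorems.PowerGaugeEulerLiouville

variable {γ : ℝ} {U V : EuclideanSpace ℝ (Fin 3) → EuclideanSpace ℝ (Fin 3)}
  {P : EuclideanSpace ℝ (Fin 3) → ℝ}

/-- `DW(y) = γ·id + DU(y)` for the transport field `W y = γ(y − 0) + U y` of a differentiable profile. [folklore] -/
theorem hasFDerivAt_selfSimilarTransport_zero (hU : Differentiable ℝ U) (y : EuclideanSpace ℝ (Fin 3)) :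
    HasFDerivAt (selfSimilarTransport γ 0 U)
      (γ • ContinuousLinearMap.id ℝ (EuclideanSpace ℝ (Fin 3)) + fderiv ℝ U y) y := by
  have h : HasFDerivAt (fun z : EuclideanSpace ℝ (Fin 3) => γ • (z - 0) + U z)
      (γ • ContinuousLinearMap.id ℝ (EuclideanSpace ℝ (Fin 3)) + fderiv ℝ U y) y :=
    (((hasFDerivAt_id y).sub_const 0).fun_const_smul γ).fun_add (hU y).hasFDerivAt
  have e : (selfSimilarTransport γ 0 U) = fun z : EuclideanSpace ℝ (Fin 3) => γ • (z - 0) + U z := by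
    funext z; rw [selfSimilarTransport_apply]
  rw [e]; exact h

/-- The second derivative of the `C²` velocity profile exists: `D(DU)(y) = D²U(y)`.
[cite: ConstantinIgnatovaVicol2026Putative, §3.1.1 eq. (3.3)] -/
theorem hasFDerivAt_fderiv_velocity (hprof : IsSelfSimilarEulerProfile γ 0 U P)
    (y : EuclideanSpace ℝ (Fin 3)) :
    HasFDerivAt (fderiv ℝ U) (fderiv ℝ (fderiv ℝ U) y) y := by
  have h1 : ContDiff ℝ 1 (fderiv ℝ U) := hprof.contDiff_velocity.fderiv_right (m := 1) (by norm_num)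
  exact (h1.differentiable one_ne_zero y).hasFDerivAt

/-- The profile equation solved for the pressure gradient, as an identity of functions:
`∇P = −(1−γ)U − DU·W`. [cite: ConstantinIgnatovaVicol2026Putative, §3.1.1 eq. (3.3)] -/
theorem gradient_pressure_eq (hprof : IsSelfSimilarEulerProfile γ 0 U P) :
    gradient P = -((1 - γ) • U + fun y => fderiv ℝ U y (selfSimilarTransport γ 0 U y)) := by
  funext y
  have e := hprof.profile_eq_transport y
  simp only [Pi.neg_apply, Pi.add_apply, Pi.smul_apply]
  linear_combination (norm := module) e

/-- **The pressure of a `C²` profile is effectively `C²`**: `∇P` is differentiable, with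
`D(∇P)(y) = −((1−γ)DU(y) + (DU(y)∘(γ·id + DU(y)) + (D²U(y)).flip (W y)))`.
[cite: ConstantinIgnatovaVicol2026Putative, §3.1.1 eq. (3.3)] -/
theorem hasFDerivAt_gradient_pressure (hprof : IsSelfSimilarEulerProfile γ 0 U P)
    (y : EuclideanSpace ℝ (Fin 3)) :
    HasFDerivAt (gradient P)
      (-((1 - γ) • fderiv ℝ U y +
        ((fderiv ℝ U y).comp (γ • ContinuousLinearMap.id ℝ (EuclideanSpace ℝ (Fin 3)) + fderiv ℝ U y) +
          (fderiv ℝ (fderiv ℝ U) y).flip (selfSimilarTransport γ 0 U y)))) y := by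
  have hU : HasFDerivAt U (fderiv ℝ U y) y := (hprof.differentiable_velocity y).hasFDerivAt
  have hD2 := hasFDerivAt_fderiv_velocity hprof y
  have hW := hasFDerivAt_selfSimilarTransport_zero (γ := γ) hprof.differentiable_velocity y
  have h := ((hU.const_smul (1 - γ)).add (hD2.clm_apply hW)).neg
  rw [gradient_pressure_eq hprof]
  exact h

/-- `D(∇P)` written out: the value of `fderiv ℝ (gradient P)`. [cite: ConstantinIgnatovaVicol2026Putative, §3.1.1 eq. (3.3)] -/
theorem fderiv_gradient_pressure_eq (hprof : IsSelfSimilarEulerProfile γ 0 U P)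
    (y : EuclideanSpace ℝ (Fin 3)) :
    fderiv ℝ (gradient P) y =
      -((1 - γ) • fderiv ℝ U y +
        ((fderiv ℝ U y).comp (γ • ContinuousLinearMap.id ℝ (EuclideanSpace ℝ (Fin 3)) + fderiv ℝ U y) +
          (fderiv ℝ (fderiv ℝ U) y).flip (selfSimilarTransport γ 0 U y))) :=
  (hasFDerivAt_gradient_pressure hprof y).fderiv

/-- Symmetry of the second derivative of the `C²` velocity profile, in the form used along orbits:
`D²U(y)(w) = (D²U(y)).flip w`. [folklore] -/
theorem fderiv_fderiv_apply_eq_flip (hprof : IsSelfSimilarEulerProfile γ 0 U P)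
    (y w : EuclideanSpace ℝ (Fin 3)) :
    fderiv ℝ (fderiv ℝ U) y w = (fderiv ℝ (fderiv ℝ U) y).flip w := by
  have hsymm : IsSymmSndFDerivAt ℝ U y :=
    (hprof.contDiff_velocity.contDiffAt (x := y)).isSymmSndFDerivAt (by simp)
  refine ContinuousLinearMap.ext fun h => ?_
  rw [ContinuousLinearMap.flip_apply]
  exact hsymm w h

/-- **THE GRADIENT RICCATI along a backward cut-off orbit, inside the ball.**  While `Ψ_σ y ∈ ball 0 R_big` (where the
cut-off field `V` agrees with `U`), the velocity gradient `A(σ) := DU(Ψ_σ y)` satisfies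
`A' = A + A∘A + D(∇P)(Ψ_σ y)`.  (Pressure-free this is the matrix Riccati equation; `tr A = 0` and `tr D(∇P) = ΔP = −tr A²`.)
[cite: ConstantinIgnatovaVicol2026Putative, §3.1.1 eq. (3.3)] -/
theorem hasDerivAt_fderiv_velocity_flow_neg (hprof : IsSelfSimilarEulerProfile γ 0 U P)
    (hV : ContDiff ℝ 1 V) {K : ℝ} (hK : ∀ y, ‖fderiv ℝ V y‖ ≤ K) {Rbig : ℝ}
    (hVU : ∀ w ∈ ball (0 : EuclideanSpace ℝ (Fin 3)) Rbig, V w = U w) (y : EuclideanSpace ℝ (Fin 3))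
    {σ : ℝ}
    (hz : ODE.evolutionMap (fun _ : ℝ => selfSimilarTransport γ 0 V) 0 (-σ) y ∈
      ball (0 : EuclideanSpace ℝ (Fin 3)) Rbig) :
    HasDerivAt
      (fun r => fderiv ℝ U (ODE.evolutionMap (fun _ : ℝ => selfSimilarTransport γ 0 V) 0 (-r) y))
      (fderiv ℝ U (ODE.evolutionMap (fun _ : ℝ => selfSimilarTransport γ 0 V) 0 (-σ) y) +
        (fderiv ℝ U (ODE.evolutionMap (fun _ : ℝ => selfSimilarTransport γ 0 V) 0 (-σ) y)).comp
          (fderiv ℝ U (ODE.evolutionMap (fun _ : ℝ => selfSimilarTransport γ 0 V) 0 (-σ) y)) +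
        fderiv ℝ (gradient P) (ODE.evolutionMap (fun _ : ℝ => selfSimilarTransport γ 0 V) 0 (-σ) y)) σ := by
  set z := ODE.evolutionMap (fun _ : ℝ => selfSimilarTransport γ 0 V) 0 (-σ) y with hzdef
  have h1 := (hasFDerivAt_fderiv_velocity hprof z).comp_hasDerivAt σ
    (C2.Kelvin.hasDerivAt_flow_neg (γ := γ) hV hK y σ)
  have hW : selfSimilarTransport γ 0 V z = selfSimilarTransport γ 0 U z := by
    rw [selfSimilarTransport_apply, selfSimilarTransport_apply, hVU z hz]
  have key : fderiv ℝ (fderiv ℝ U) z ((-1 : ℝ) • selfSimilarTransport γ 0 V z) =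
      fderiv ℝ U z + (fderiv ℝ U z).comp (fderiv ℝ U z) + fderiv ℝ (gradient P) z := by
    rw [map_smul, hW, fderiv_fderiv_apply_eq_flip hprof z, fderiv_gradient_pressure_eq hprof z,
      ContinuousLinearMap.comp_add, ContinuousLinearMap.comp_smul, ContinuousLinearMap.comp_id]
    module
  rw [← hzdef] at h1
  rw [key] at h1
  exact h1

end Summit.NavierStokesRegularity.NavierStokesRegularity.Theorems.PowerGaugeEulerLiouville.Condenser

end
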